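import Summits.BirchSwinnertonDyer.BirchSwinnertonDyer.Theorems.KolyvaginRankRigidityAtTwoWalkStepRefill
import Summits.BirchSwinnertonDyer.BirchSwinnertonDyer.Theorems.ClassRecordThreeEulerHalvesAtThreeWalkSupplyTransverse
import Summits.BirchSwinnertonDyer.BirchSwinnertonDyer.Theorems.ClassRecordThreeEulerHalvesAtThreeWalkStructures
import Summits.BirchSwinnertonDyer.Rank1Residual.X11b.KolyvaginReciprocityFinsetOfPoitouTate
import Literature.NumberTheory.EllipticCurves.CasselsTateSelmerKolyvaginValue
import HarnessLib

/-!
# Crux U1 `KolyvaginBoundedDefectAtTwo` (stmt-BirchSwinnertonDyer-28083), LINE 17 `regular_core_rigidity` v3,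
# stub S1b `stub_nearCoreExistenceAtTwo` — ONE STEP OF THE WALK, TRANSFER LEMMAS: from the value engine's output to
# the step-local layer

Width seat `bsd-line-krr2-p2` g14 (ONE READER on S1b); `--supports stmt-BirchSwinnertonDyer-28083` (helper). THEOREMS
ONLY; nothing here proves S1b, U1, a rung or BSD. BSD is NOT proved.

The value engine (`…RegularValueEngineTwoLevel`, p688489) speaks of restrictions to `Γ_{K(E[2^(k+1)])}` (`h1Eval`) and
of `torsionLocalKer`; the step-local layer (`…WalkStepLocal/Refill/Sign/RefillClass`) speaks of `loc_v`, of
`H¹_{𝓕(c)}` for a transverse family `𝒯`, and of `H¹_{𝓕(c)[v ↦ Kum_v]}`. This file supplies the dictionary.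
* **`localization_eq_zero_of_forall_h1Eval_eq_zero`** (Φ-KILL) — at a place `v` over a Kolyvagin prime of index
  `≥ k+1`, a class of `H¹(K, E[2^k])` vanishing on `Γ_{K(E[2^(k+1)])}` has `loc_v = 0` (`Γ_{K_v}` fixes `E[2^(k+1)]`,
  `galoisRep_toLocal_apply_eq_self`; so `loc_v` FACTORS THROUGH the restriction to `Γ_{K(E[2^(k+1)])}`);
* `addOrderOf_localization_eq_two_pow` — the engine's exact-order clauses
  (`2^N • x ∈ torsionLocalKer`, `2^(N−1) • x ∉ torsionLocalKer`) say `addOrderOf (loc_v x) = 2^N`;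
* `selmerF_eq_of_forall_eq` — two transverse families agreeing at the places dividing `c` define the same `𝓕(c)`
  (used with the GLOBAL family of `JET.Walk.exists_globalTransverseFamily` and the per-conductor families of
  g13's lemmas, `JET.Walk.globalTransverse_eq_of_mem_placesDividing`);
* `update_selmerF_insert_eq` — `𝓕_{insert v S}[v ↦ Kum_v] = 𝓕_S` for `v ∉ S`: with
  `JET.Walk.placesDividing_mul_eq_insert`, the previous vertex `H¹_{𝓕(c)}` of the walk IS the group
  `H¹_{𝓕(cℓ)[v ↦ Kum_v]}` of the step-local layer;
* `selmerF_insert_inr_self` — `𝓕_{insert v S}(v) = 𝒯_v`.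
References (locators only; no cited FACT is declared): [cite: McCallumLMS1991, Prop. 4.4 (proof)]
[cite: Jetchev2008, §3.4.1] [cite: MazurRubin2004, §4.1].
Design: no definitions; `K : Type`; axioms `propext`, `Classical.choice`, `Quot.sound`.
-/

set_option autoImplicit false
-- the Theorems namespace of this sub repeats the summit name by design (D-0017 nested layout)
set_option linter.dupNamespace false

noncomputable section

open scoped Classical
open Function NumberField IsDedekindDomain WeierstrassCurve Field
open Literature.NumberTheory.EllipticCurves Literature.NumberTheory.EllipticCurves.Jetchev2008
open Literature.NumberTheory.EllipticCurves.KolyvaginPairing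
open Literature.NumberTheory.GaloisRepresentations Literature.NumberTheory.GaloisCohomology
open Literature.NumberTheory.GaloisRepresentations.DiscreteGaloisModule (transverseSubgroup SelmerStructure)
open Literature.NumberTheory.Automorphic
open Summit.BirchSwinnertonDyer.Rank1Residual
open Summit.BirchSwinnertonDyer.Rank1Residual.JET.SelmerVocabulary
open Summit.BirchSwinnertonDyer.Rank1Residual.JET.GlobalDuality (galoisRep_toLocal_apply_eq_self)

namespace Summit.BirchSwinnertonDyer.BirchSwinnertonDyer.Theorems.KolyvaginAtTwo.RegularRefill

variable {K : Type} [Field K] [NumberField K] (W : WeierstrassCurve ℚ) [W.IsElliptic] [W.IsGloballyMinimal]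

/-! ### §1 `loc_v` factors through the restriction to `Γ_{K(E[2^(k+1)])}` -/

/-- **Φ-KILL.** `K` imaginary quadratic, `ℓ` a Zhang–Kolyvagin prime at `2` of index `≥ k + 1`, `v ∋ ℓ`. A class
`x ∈ H¹(K, E[2^k])` whose (chosen) cocycle vanishes on `Γ_{K(E[2^(k+1)])}` is locally trivial at `v`: the image of
`Γ_{K_v} → Γ_K` fixes `E[2^(k+1)]` (`galoisRep_toLocal_apply_eq_self`), so the restricted cocycle is identically
zero. Hence `loc_v x` only depends on the restriction of `x` to `Γ_{K(E[2^(k+1)])}` — the bridge between the value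
engine (which prescribes restrictions) and the step-local layer (which reads `loc_v`).
[cite: McCallumLMS1991, Prop. 4.4 (proof)] [cite: GrossLMS1991, §9] -/
theorem localization_eq_zero_of_forall_h1Eval_eq_zero (hK : IsImaginaryQuadratic K) {k ℓ : ℕ}
    (hℓ : Zhang2014.IsKolyvaginPrime (W.conductorNorm ℤ) W K 2 ℓ) (hk1 : k + 1 ≤ Zhang2014.kolyvaginIndex W 2 ℓ)
    (v : HeightOneSpectrum (𝓞 K)) (hv : (ℓ : 𝓞 K) ∈ v.asIdeal)
    {x : galH1Torsion (W.baseChange K) ((2 ^ k : ℕ) : ℤ)}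
    (hx : ∀ ρ ∈ torsionFixing (W.baseChange K) ((2 ^ (k + 1) : ℕ) : ℤ),
      h1Eval (W.baseChange K) ((2 ^ k : ℕ) : ℤ) x ρ = 0) :
    galoisCohomology.localization ((W.baseChange K).torsionGaloisModule ((2 ^ k : ℕ) : ℤ)) (Sum.inr v : Place K) 1
      x = 0 := by
  haveI : Fact (Nat.Prime 2) := ⟨Nat.prime_two⟩
  apply X11b.KolyvaginReciprocity.localization_eq_zero_of_mem_torsionLocalKer (W.baseChange K)
    (n := ((2 ^ k : ℕ) : ℤ)) (by positivity) v
  rw [← oneCocycleClass_reprCocycle (W.baseChange K) ((2 ^ k : ℕ) : ℤ) x]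
  change oneCocycleClass _ _ ∈ resKer (resGal (K := K) (v.adicCompletion K))
    (torsionPointsMap (W.baseChange K) (v.adicCompletion K) ((2 ^ k : ℕ) : ℤ))
    (torsionPointsMap_smul (W.baseChange K) (v.adicCompletion K) ((2 ^ k : ℕ) : ℤ))
  rw [oneCocycleClass_mem_resKer_iff]
  refine ⟨0, fun σ ↦ ?_⟩
  have hmem : resGal (K := K) (v.adicCompletion K) σ ∈ torsionFixing (W.baseChange K) ((2 ^ (k + 1) : ℕ) : ℤ) := by
    rw [mem_torsionFixing_iff]
    intro P
    exact galoisRep_toLocal_apply_eq_self W K hK hℓ hk1 v hv σ P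
  have h0 : (reprCocycle (W.baseChange K) ((2 ^ k : ℕ) : ℤ) x).1 (resGal (K := K) (v.adicCompletion K) σ) = 0 :=
    hx _ hmem
  rw [h0, map_zero, smul_zero, sub_zero]

omit [W.IsGloballyMinimal] in
/-- **Exact local order from the engine's clauses.** If `2^N • x ∈ torsionLocalKer_v` and (for `N ≠ 0`)
`2^(N−1) • x ∉ torsionLocalKer_v`, then `addOrderOf (loc_v x) = 2^N`. [folklore] -/
theorem addOrderOf_localization_eq_two_pow {k N : ℕ} (v : HeightOneSpectrum (𝓞 K))
    {x : galH1Torsion (W.baseChange K) ((2 ^ k : ℕ) : ℤ)}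
    (h1 : ((2 : ℤ) ^ N) • x ∈ (W.baseChange K).torsionLocalKer (v.adicCompletion K) ((2 ^ k : ℕ) : ℤ))
    (h2 : N ≠ 0 → ((2 : ℤ) ^ (N - 1)) • x ∉ (W.baseChange K).torsionLocalKer (v.adicCompletion K) ((2 ^ k : ℕ) : ℤ)) :
    addOrderOf (galoisCohomology.localization ((W.baseChange K).torsionGaloisModule ((2 ^ k : ℕ) : ℤ))
      (Sum.inr v : Place K) 1 x) = 2 ^ N := by
  haveI : CharZero (v.adicCompletion K) := charZero_of_injective_algebraMap (algebraMap K _).injective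
  have hk0 : (2 ^ k : ℕ) ≠ 0 := by positivity
  have hiff : ∀ y : galH1Torsion (W.baseChange K) ((2 ^ k : ℕ) : ℤ),
      y ∈ (W.baseChange K).torsionLocalKer (v.adicCompletion K) ((2 ^ k : ℕ) : ℤ) ↔
        galoisCohomology.localization ((W.baseChange K).torsionGaloisModule ((2 ^ k : ℕ) : ℤ))
          (Sum.inr v : Place K) 1 y = 0 :=
    fun y ↦ mem_torsionLocalKer_iff_res_eq_zero (W.baseChange K) (v.adicCompletion K) (k := 2 ^ k) hk0 y
  set loc := galoisCohomology.localization ((W.baseChange K).torsionGaloisModule ((2 ^ k : ℕ) : ℤ))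
    (Sum.inr v : Place K) 1 with hloc
  have hz : ∀ (m : ℕ) (y : galH1Torsion (W.baseChange K) ((2 ^ k : ℕ) : ℤ)), loc (((2 : ℤ) ^ m) • y) = (2 ^ m) • loc y :=
    fun m y ↦ by
      have e : loc (((2 : ℤ) ^ m) • y) = ((2 : ℤ) ^ m) • loc y := map_zsmul loc _ _
      have hc : ((2 ^ m : ℕ) : ℤ) = (2 : ℤ) ^ m := by rw [Nat.cast_pow, Nat.cast_ofNat]
      exact e.trans (by rw [← natCast_zsmul, hc])
  have hN : (2 ^ N) • loc x = 0 := by rw [← hz]; exact (hiff _).mp h1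
  rcases Nat.eq_zero_or_pos N with rfl | hpos
  · rw [pow_zero, one_nsmul] at hN
    rw [hN, addOrderOf_zero, pow_zero]
  · obtain ⟨n, rfl⟩ : ∃ n, N = n + 1 := ⟨N - 1, (Nat.sub_add_cancel hpos).symm⟩
    haveI : Fact (Nat.Prime 2) := ⟨Nat.prime_two⟩
    refine addOrderOf_eq_prime_pow (fun h ↦ h2 (Nat.succ_ne_zero n) ?_) hN
    rw [Nat.add_sub_cancel]
    exact (hiff _).mpr (by rw [hz]; exact h)

/-! ### §2 Structure identities for the conductor update `c ↦ cℓ` -/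

omit [W.IsElliptic] [W.IsGloballyMinimal] in
/-- Two transverse families that agree at the places of `S` define the same structure `𝓕_S` (`selmerF`).
[cite: Jetchev2008, §3.4.1] -/
theorem selmerF_eq_of_forall_eq (n : ℤ) (𝒯 𝒯' : SelmerStructure ((W.baseChange K).torsionGaloisModule n))
    (S : Finset (HeightOneSpectrum (𝓞 K))) (h : ∀ v ∈ S, 𝒯 (Sum.inr v) = 𝒯' (Sum.inr v)) :
    selmerF W n 𝒯 S = selmerF W n 𝒯' S := by
  funext p
  rcases p with w | v
  · rw [selmerF_inl, selmerF_inl]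
  · rw [selmerF_inr, selmerF_inr]
    by_cases hv : v ∈ S
    · rw [if_pos hv, if_pos hv, h v hv]
    · rw [if_neg hv, if_neg hv]

omit [W.IsElliptic] [W.IsGloballyMinimal] in
/-- **`𝓕_{insert v S}[v ↦ Kum_v] = 𝓕_S`** for `v ∉ S`: the previous vertex of the walk, `H¹_{𝓕(c)}`, is the group
`H¹_{𝓕(cℓ)[λ ↦ Kum_λ]}` of the step-local layer (`placesDividing K (cℓ) = insert λ (placesDividing K c)`,
`JET.Walk.placesDividing_mul_eq_insert`). [cite: Jetchev2008, §3.4.1] [cite: MazurRubin2004, §4.1] -/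
theorem update_selmerF_insert_eq (n : ℤ) (𝒯 : SelmerStructure ((W.baseChange K).torsionGaloisModule n))
    (S : Finset (HeightOneSpectrum (𝓞 K))) {v : HeightOneSpectrum (𝓞 K)} (hv : v ∉ S) :
    (Function.update (selmerF W n 𝒯 (insert v S)) (Sum.inr v : Place K)
        ((W.baseChange K).kummerSelmerStructure n (Sum.inr v : Place K)) :
        SelmerStructure ((W.baseChange K).torsionGaloisModule n)) = selmerF W n 𝒯 S := by
  funext p
  rcases p with w | w
  · rw [Function.update_of_ne (by simp), selmerF_inl, selmerF_inl]
  · by_cases hw : w = v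
    · subst hw
      rw [Function.update_self, selmerF_inr, if_neg hv]
    · rw [Function.update_of_ne (by simpa using hw), selmerF_inr, selmerF_inr]
      by_cases hwS : w ∈ S
      · rw [if_pos (Finset.mem_insert_of_mem hwS), if_pos hwS]
      · rw [if_neg (fun h ↦ (Finset.mem_insert.mp h).elim hw hwS), if_neg hwS]

omit [W.IsElliptic] [W.IsGloballyMinimal] in
/-- `𝓕_{insert v S}(v) = 𝒯_v`. [cite: Jetchev2008, §3.4.1] -/
theorem selmerF_insert_inr_self (n : ℤ) (𝒯 : SelmerStructure ((W.baseChange K).torsionGaloisModule n))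
    (S : Finset (HeightOneSpectrum (𝓞 K))) (v : HeightOneSpectrum (𝓞 K)) :
    selmerF W n 𝒯 (insert v S) (Sum.inr v) = 𝒯 (Sum.inr v) := by
  rw [selmerF_inr, if_pos (Finset.mem_insert_self v S)]

omit [W.IsElliptic] [W.IsGloballyMinimal] in
/-- **The previous vertex as an update, at the conductor level**: for `c` square-free, `ℓ ∤ c` an inert prime with
place `v`, `𝓕(cℓ)[v ↦ Kum_v] = 𝓕(c)`. [cite: Jetchev2008, §3.4.1] -/
theorem update_selmerF_placesDividing_mul_eq (n : ℤ) (𝒯 : SelmerStructure ((W.baseChange K).torsionGaloisModule n))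
    {c ℓ : ℕ} (hc : c ≠ 0) (hℓ : ℓ.Prime) (hℓc : ¬ ℓ ∣ c) (hprime : (Ideal.span {(ℓ : 𝓞 K)}).IsPrime)
    {v : HeightOneSpectrum (𝓞 K)} (hv : (ℓ : 𝓞 K) ∈ v.asIdeal) :
    (Function.update (selmerF W n 𝒯 (placesDividing K (c * ℓ))) (Sum.inr v : Place K)
        ((W.baseChange K).kummerSelmerStructure n (Sum.inr v : Place K)) :
        SelmerStructure ((W.baseChange K).torsionGaloisModule n)) = selmerF W n 𝒯 (placesDividing K c) := by
  rw [JET.Walk.placesDividing_mul_eq_insert hc hℓ hprime hv]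
  refine update_selmerF_insert_eq W n 𝒯 _ fun hvc ↦ hℓc ?_
  rw [mem_placesDividing_iff_natCast_mem hc] at hvc
  by_contra hdvd
  exact Literature.NumberTheory.NumberFields.Honda1971.natCast_notMem_of_coprime
    ((Nat.Prime.coprime_iff_not_dvd hℓ).mpr hdvd) v hv hvc

end Summit.BirchSwinnertonDyer.BirchSwinnertonDyer.Theorems.KolyvaginAtTwo.RegularRefill

end
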